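import Summits.QuantumFields.YangMills.Theorems.FluctuationComparisonRegPrIntLTailSupOneFibreRows
import Literature.MathematicalPhysics.QuantumFieldTheory.Balaban1983to89.B10Eq71TorusLocal
import HarnessLib

/-!
# `FluctuationComparisonRegPrIntLTailSupOneFarPlaquetteCost` — LINE g21-2 «DEPTH-ONE WINDOW ODDS BY A MEASURE SPLIT»: THE ACTION COST OF ONE FAR PLAQUETTE,
# AND FPT ∕ FAR₁'s FIBRE SENTENCE REDUCED TO THE «DELETED-PLAQUETTE PARTITION FUNCTION» COMPARISON
# (crux `UnitScaleTilt.FluctuationComparisonRegPrIntL`, stmt-QuantumFields-20520; rows FAR₁ `FarFieldOddsDepthOneCan` ∕ FPT `PinnedFarOddsDepthOneCan` of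
# `Cruxes/…/Lines/tailsup_one.lean` v1.3+, ideator ym-r3-idea-1 g21)

Cell `ym3-torus` (YM ladder rung R3 = continuum SU(2) Yang–Mills on T³ — a RUNG, NOT the Clay problem: not d = 4, not infinite volume, not a mass gap);
width seat `ym-ust-20520-w3` (gen 17); helper `--supports stmt-QuantumFields-20520`.  THEOREMS ONLY (0 `def`, 0 `sorry`, default heartbeats).

WHAT.  FPT's fibre sentence (after ✓E): for Haar-a.e. window datum `V` and one finest plaquette `p`, `κ_V(far at p) ≤ σ·κ_V(histGood)` for the Boltzmann-weighted
conditional Haar law `κ_V`.  Print's mechanism («a `δ₀`-plaquette costs `≥ cδ₀²β` of action; remove the bad plaquette term») has a DETERMINISTIC half and a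
PROBABILISTIC half; this file proves the first and isolates the second:
* §1 ★`plaq_le_wilsonAction4` (`1 − Re tr U(∂p) ≤ A(U)`; `A_{¬p} := A − (1 − Re tr U(∂p)) ≥ 0`, `deletedAction_nonneg`), `quarter_dist1_sq_le_one_sub_reTr` (on `SU(2)`: `dist1(W)²∕4 ≤ 1 − reTr W`,
  lit ✓`B10Eq71TorusLocal.dist1_sq_le_specialUnitaryGroup` = [Balaban1985UV3] (11)), ★★`boltzmann_le_of_far` — on `{δ₀ ≤ dist1 U(∂p)}`:
  `e^{−βA(U)} ≤ e^{−βδ₀²∕4}·e^{−βA_{¬p}(U)}` (`β, δ₀ ≥ 0`).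
* §2 (any measure `κ` on fine fields) ★`setLIntegral_far_le` — `∫⁻_{far at p} e^{−βA} dκ ≤ e^{−βδ₀²∕4}·∫⁻ e^{−βA_{¬p}} dκ`; ★★`far_fibre_of_deletedPartition` — IF the
  DELETED-PLAQUETTE PARTITION FUNCTION is controlled by the good mass, `∫⁻ e^{−βA_{¬p}} dκ ≤ C·∫⁻_{G} e^{−βA} dκ` (the hand's residual: «the four links of `p` stay
  pinned near the local minimiser by their OTHER plaquettes and the block constraint, so freeing `p`'s own term costs a bounded factor»), THEN
  `∫⁻_{far at p} e^{−βA} dκ ≤ (e^{−βδ₀²∕4}·C)·∫⁻_G e^{−βA} dκ`.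
* §3 (the runs) ★★★`gibbsK_restrict_map_farPinned_le` — the a.e.-fibrewise deleted-partition bound for `κ_V = condLaw dU_K D_{J,K} V` ⇒ the FPT-shaped measure row
  `(D_*(Gibbs_K|{δ₀ ≤ dist1 U(∂p)}))|W_J ≤ ofReal(e^{−β_Kδ₀²∕4}·C) • (D_*(Gibbs_K|G))|W_J` (✓E `gibbsK_restrict_map_le_of_fibrewise`).
* §4 `superpoly_of_le_geometric_ratio` — `0 ≤ τ J ≤ A'·r^J`, `0 ≤ r < 1` ⇒ `∀ a, (J+1)^a·τ J → 0` (the modulus `e^{−β_{J+1}δ₀²∕4} = e^{−δ₀²∕(4g²_{J+1})}` is of this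
  class, `g²_{J+1} ≍ γL^{−(J+1)}`).
HONEST SCOPE.  Action arithmetic + measure bookkeeping; the deleted-plaquette comparison (the probabilistic half of FPT ∕ FAR₁) is the HYPOTHESIS; FPT, FAR₁, MOD₁,
TAILSUP₁, LFR♯ᶜ, S2β, 20520, `YM3TorusSU2` NOT proved; the Yang–Mills mass gap is NOT proved.
References: [Balaban1985UV3] (7) p. 257, (11) p. 258, (67)–(71) p. 273; [Balaban1989LargeFieldII] (1.95) p. 389.
-/

noncomputable section

set_option autoImplicit false

open MeasureTheory ProbabilityTheory Filter Topology Set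
open scoped ENNReal NNReal BigOperators
open Literature.MathematicalPhysics.QuantumFieldTheory.Balaban1983to89
open Literature.MathematicalPhysics.QuantumFieldTheory.Balaban1983to89.T3ContinuumYM3Torus
open Literature.MathematicalPhysics.QuantumFieldTheory.Balaban1983to89.T3NestedUnitLaws
open Literature.MathematicalPhysics.QuantumFieldTheory.Balaban1983to89.T3UnitLawDensityEML
open Literature.MathematicalPhysics.QuantumFieldTheory.Balaban1983to89.T3UnitScaleTilt
open Literature.MathematicalPhysics.QuantumFieldTheory.Balaban1983to89.T3TiltDescent
open Literature.MathematicalPhysics.QuantumFieldTheory.Balaban1983to89.Missing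
open Literature.MathematicalPhysics.QuantumFieldTheory.Balaban1983to89.T4AveragingDisintegration
open Literature.MathematicalPhysics.QuantumFieldTheory.Balaban1983to89.B10Eq71TorusLocal (dist1_sq_le_specialUnitaryGroup)
open Summit.QuantumFields.YangMills.Theorems.FluctuationComparisonRegPrIntLTailSupOneFibreRows (gibbsK_restrict_map_le_of_fibrewise)

namespace Summit.QuantumFields.YangMills.Theorems.FluctuationComparisonRegPrIntLTailSupOneFarPlaquetteCost

/-! ## §1 The action cost of one far plaquette (deterministic) -/

section Action

variable {P : Params}

/-- ★ **ONE PLAQUETTE's TERM IS BELOW THE ACTION**: `1 − Re tr U(∂p) ≤ A(U)`, i.e. the deleted-plaquette action `A_{¬p}(U) := A(U) − (1 − Re tr U(∂p))`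
(`= Σ_{q ≠ p} (1 − Re tr U(∂q))`, written as a difference so that no decidable equality of plaquettes enters the statements) is non-negative.
[cite: Balaban1987RG1, (0.2) p.252] -/
theorem plaq_le_wilsonAction4 (U : GaugeField P 0 (Matrix.specialUnitaryGroup (Fin 2) ℂ)) (p : Plaq P 0) :
    1 - reTr (GaugeField.plaqHol U p) ≤ wilsonAction4 U := by
  unfold wilsonAction4 wilsonAction
  simp only [one_mul]
  exact Finset.single_le_sum (f := fun q => 1 - reTr (GaugeField.plaqHol U q))
    (fun q _ => by linarith [GaugeGroup.reTr_le_one (GaugeField.plaqHol U q)]) (Finset.mem_univ p)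

/-- The deleted-plaquette action `A_{¬p}(U) = A(U) − (1 − Re tr U(∂p))` is non-negative. [cite: Balaban1987RG1, (0.2) p.252] -/
theorem deletedAction_nonneg (U : GaugeField P 0 (Matrix.specialUnitaryGroup (Fin 2) ℂ)) (p : Plaq P 0) :
    0 ≤ (wilsonAction4 U - (1 - reTr (GaugeField.plaqHol U p))) := by
  linarith [plaq_le_wilsonAction4 U p]

/-- On `SU(2)`: `dist1(W)²∕4 ≤ 1 − reTr W` ([Balaban1985UV3] (11) at `N = 2`, lit ✓`dist1_sq_le_specialUnitaryGroup`). [cite: Balaban1985UV3, (11) p.258] -/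
theorem quarter_dist1_sq_le_one_sub_reTr (W : Matrix.specialUnitaryGroup (Fin 2) ℂ) : dist1 W ^ 2 / 4 ≤ 1 - reTr W := by
  have h := dist1_sq_le_specialUnitaryGroup (N := 2) W
  push_cast at h
  linarith

/-- ★★ **A FAR PLAQUETTE COSTS ACTION**: if `δ₀ ≤ dist1 U(∂p)` (`δ₀ ≥ 0`, `β ≥ 0`) then `e^{−βA(U)} ≤ e^{−βδ₀²∕4}·e^{−βA_{¬p}(U)}` — the plaquette's own term is
`≥ δ₀²∕4`, the rest is kept.  The deterministic half of print's «remove the bad plaquette» mechanism. [cite: Balaban1985UV3, (11) p.258 and (67)-(71) p.273] -/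
theorem boltzmann_le_of_far {β δ₀ : ℝ} (hβ : 0 ≤ β) (hδ : 0 ≤ δ₀) (U : GaugeField P 0 (Matrix.specialUnitaryGroup (Fin 2) ℂ)) (p : Plaq P 0)
    (hfar : δ₀ ≤ dist1 (GaugeField.plaqHol U p)) :
    boltzmann P β U ≤
      Real.exp (-(β * δ₀ ^ 2 / 4)) * Real.exp (-(β * (wilsonAction4 U - (1 - reTr (GaugeField.plaqHol U p))))) := by
  unfold boltzmann
  rw [← Real.exp_add]
  refine Real.exp_le_exp.mpr ?_
  have hsq : δ₀ ^ 2 ≤ dist1 (GaugeField.plaqHol U p) ^ 2 := pow_le_pow_left₀ hδ hfar 2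
  have hcost : δ₀ ^ 2 / 4 ≤ 1 - reTr (GaugeField.plaqHol U p) :=
    (div_le_div_of_nonneg_right hsq (by norm_num)).trans (quarter_dist1_sq_le_one_sub_reTr _)
  nlinarith [deletedAction_nonneg U p, mul_le_mul_of_nonneg_left hcost hβ]

end Action

/-! ## §2 For ANY measure on fine fields: the far event's weighted mass vs the deleted-plaquette partition function -/

section Fibre

variable {P : Params} (κ : Measure (GaugeField P 0 (Matrix.specialUnitaryGroup (Fin 2) ℂ))) {β δ₀ : ℝ}

/-- ★ **`∫⁻_{far at p} e^{−βA} dκ ≤ e^{−βδ₀²∕4}·∫⁻ e^{−βA_{¬p}} dκ`** for every measure `κ` on the fine fields (e.g. the Boltzmann-free conditional Haar law of a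
fibre), `β, δ₀ ≥ 0`. [cite: Balaban1985UV3, (67)-(71) p.273] -/
theorem setLIntegral_far_le (hβ : 0 ≤ β) (hδ : 0 ≤ δ₀) (p : Plaq P 0) :
    ∫⁻ U in {U | δ₀ ≤ dist1 (GaugeField.plaqHol U p)}, ENNReal.ofReal (boltzmann P β U) ∂κ ≤
      ENNReal.ofReal (Real.exp (-(β * δ₀ ^ 2 / 4))) *
        ∫⁻ U, ENNReal.ofReal (Real.exp (-(β * (wilsonAction4 U - (1 - reTr (GaugeField.plaqHol U p)))))) ∂κ := by
  calc ∫⁻ U in {U | δ₀ ≤ dist1 (GaugeField.plaqHol U p)}, ENNReal.ofReal (boltzmann P β U) ∂κ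
      ≤ ∫⁻ U in {U | δ₀ ≤ dist1 (GaugeField.plaqHol U p)}, ENNReal.ofReal (Real.exp (-(β * δ₀ ^ 2 / 4))) *
          ENNReal.ofReal (Real.exp (-(β * (wilsonAction4 U - (1 - reTr (GaugeField.plaqHol U p)))))) ∂κ := by
        refine setLIntegral_mono' ?_ ?_
        · exact measurableSet_le measurable_const
            (RegularGaugeGroup.measurable_dist1.comp (Missing.measurable_plaqHol p))
        · intro U hU
          rw [← ENNReal.ofReal_mul (Real.exp_pos _).le]
          exact ENNReal.ofReal_le_ofReal (boltzmann_le_of_far hβ hδ U p hU)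
    _ ≤ ∫⁻ U, ENNReal.ofReal (Real.exp (-(β * δ₀ ^ 2 / 4))) *
          ENNReal.ofReal (Real.exp (-(β * (wilsonAction4 U - (1 - reTr (GaugeField.plaqHol U p)))))) ∂κ :=
        setLIntegral_le_lintegral _ _
    _ = ENNReal.ofReal (Real.exp (-(β * δ₀ ^ 2 / 4))) *
          ∫⁻ U, ENNReal.ofReal (Real.exp (-(β * (wilsonAction4 U - (1 - reTr (GaugeField.plaqHol U p)))))) ∂κ := by
        rw [lintegral_const_mul']
        exact ENNReal.ofReal_ne_top

/-- ★★ **FPT's FIBRE SENTENCE ⟸ THE DELETED-PLAQUETTE PARTITION BOUND**: if `∫⁻ e^{−βA_{¬p}} dκ ≤ C·∫⁻_G e^{−βA} dκ` (freeing plaquette `p`'s own term costs at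
most the factor `C` relative to the good mass — the hand's residual), then `∫⁻_{far at p} e^{−βA} dκ ≤ ofReal(e^{−βδ₀²∕4}·C)·∫⁻_G e^{−βA} dκ`.
[cite: Balaban1985UV3, (67)-(71) p.273; Balaban1989LargeFieldII, (1.95) p.389] -/
theorem far_fibre_of_deletedPartition (hβ : 0 ≤ β) (hδ : 0 ≤ δ₀) (p : Plaq P 0)
    {G : Set (GaugeField P 0 (Matrix.specialUnitaryGroup (Fin 2) ℂ))} {C : ℝ}
    (hdel : ∫⁻ U, ENNReal.ofReal (Real.exp (-(β * (wilsonAction4 U - (1 - reTr (GaugeField.plaqHol U p)))))) ∂κ ≤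
      ENNReal.ofReal C * ∫⁻ U in G, ENNReal.ofReal (boltzmann P β U) ∂κ) :
    ∫⁻ U in {U | δ₀ ≤ dist1 (GaugeField.plaqHol U p)}, ENNReal.ofReal (boltzmann P β U) ∂κ ≤
      ENNReal.ofReal (Real.exp (-(β * δ₀ ^ 2 / 4)) * C) * ∫⁻ U in G, ENNReal.ofReal (boltzmann P β U) ∂κ := by
  calc ∫⁻ U in {U | δ₀ ≤ dist1 (GaugeField.plaqHol U p)}, ENNReal.ofReal (boltzmann P β U) ∂κ
      ≤ ENNReal.ofReal (Real.exp (-(β * δ₀ ^ 2 / 4))) *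
          ∫⁻ U, ENNReal.ofReal (Real.exp (-(β * (wilsonAction4 U - (1 - reTr (GaugeField.plaqHol U p)))))) ∂κ :=
        setLIntegral_far_le κ hβ hδ p
    _ ≤ ENNReal.ofReal (Real.exp (-(β * δ₀ ^ 2 / 4))) * (ENNReal.ofReal C * ∫⁻ U in G, ENNReal.ofReal (boltzmann P β U) ∂κ) :=
        mul_le_mul' le_rfl hdel
    _ = ENNReal.ofReal (Real.exp (-(β * δ₀ ^ 2 / 4)) * C) * ∫⁻ U in G, ENNReal.ofReal (boltzmann P β U) ∂κ := by
        rw [ENNReal.ofReal_mul (Real.exp_pos _).le, mul_assoc]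

end Fibre

/-! ## §3 The runs: the FPT-shaped measure row from the a.e.-fibrewise deleted-partition bound -/

section Runs

variable (F : T3Family) {γ : ℝ} (b₀ p₀ : ℝ) {J K : ℕ} (hJK : J ≤ K)

/-- ★★★ **FPT's MEASURE ROW ⟸ THE a.e.-FIBREWISE DELETED-PLAQUETTE BOUND**: for `γ ≥ 0`, `δ₀ ≥ 0`, a finest plaquette `p` of run `K`, a measurable good event `G` and
a real `C`: if for `(dU_K.map D_{J,K})`-a.e. window datum `V` the conditional Haar law `κ_V` satisfies `∫⁻ e^{−β_K A_{¬p}} dκ_V ≤ C·∫⁻_G e^{−β_K A} dκ_V`, then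
`(D_*(Gibbs_K|{δ₀ ≤ dist1 U(∂p)}))|W_J ≤ ofReal(e^{−β_Kδ₀²∕4}·C) • (D_*(Gibbs_K|G))|W_J` — at `K = J+1`, `G = histGood (J+1) J` this is the pinned far row FPT's
inequality with `σ(J) = C·e^{−β_{J+1}δ₀²∕4}` (§2 ∘ ✓E `gibbsK_restrict_map_le_of_fibrewise`). [cite: Balaban1985UV3, (67)-(71) p.273; Balaban1985Averaging, (10) p.19] -/
theorem gibbsK_restrict_map_farPinned_le (hγ : 0 ≤ γ) {δ₀ : ℝ} (hδ : 0 ≤ δ₀) (p : Plaq (F.P K) 0)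
    {G : Set (GaugeField (F.P K) 0 (Matrix.specialUnitaryGroup (Fin 2) ℂ))} (hG : MeasurableSet G) {C : ℝ}
    (hdel : ∀ᵐ V ∂((fieldMeasure (F.P K) 0 (Matrix.specialUnitaryGroup (Fin 2) ℂ)).map (descendTo F ℰp J K hJK)),
      PlaqSmall (θBal F.L γ b₀ p₀ J) V →
        ∫⁻ U, ENNReal.ofReal (Real.exp (-((F.scheme ℰp γ).β K * (wilsonAction4 U - (1 - reTr (GaugeField.plaqHol U p))))))
            ∂(condLaw (fieldMeasure (F.P K) 0 (Matrix.specialUnitaryGroup (Fin 2) ℂ)) (descendTo F ℰp J K hJK) V) ≤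
          ENNReal.ofReal C * ∫⁻ U in G, ENNReal.ofReal (boltzmann (F.P K) ((F.scheme ℰp γ).β K) U)
            ∂(condLaw (fieldMeasure (F.P K) 0 (Matrix.specialUnitaryGroup (Fin 2) ℂ)) (descendTo F ℰp J K hJK) V)) :
    (Measure.map (descendTo F ℰp J K hJK) ((gibbsK F ℰp γ K).restrict
        {U : GaugeField (F.P K) 0 (Matrix.specialUnitaryGroup (Fin 2) ℂ) | δ₀ ≤ dist1 (GaugeField.plaqHol U p)})).restrict
        {U : GaugeField (F.P J) 0 (Matrix.specialUnitaryGroup (Fin 2) ℂ) | PlaqSmall (θBal F.L γ b₀ p₀ J) U} ≤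
      ENNReal.ofReal (Real.exp (-((F.scheme ℰp γ).β K * δ₀ ^ 2 / 4)) * C) •
        (Measure.map (descendTo F ℰp J K hJK) ((gibbsK F ℰp γ K).restrict G)).restrict
          {U : GaugeField (F.P J) 0 (Matrix.specialUnitaryGroup (Fin 2) ℂ) | PlaqSmall (θBal F.L γ b₀ p₀ J) U} := by
  have hβ : 0 ≤ (F.scheme ℰp γ).β K := F.scheme_β_nonneg ℰp hγ K
  have hE : MeasurableSet {U : GaugeField (F.P K) 0 (Matrix.specialUnitaryGroup (Fin 2) ℂ) | δ₀ ≤ dist1 (GaugeField.plaqHol U p)} :=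
    measurableSet_le measurable_const (RegularGaugeGroup.measurable_dist1.comp (Missing.measurable_plaqHol p))
  refine gibbsK_restrict_map_le_of_fibrewise F b₀ p₀ hJK hE hG ?_
  filter_upwards [hdel] with V hV hVW
  have h := far_fibre_of_deletedPartition
    (condLaw (fieldMeasure (F.P K) 0 (Matrix.specialUnitaryGroup (Fin 2) ℂ)) (descendTo F ℰp J K hJK) V) hβ hδ p (hV hVW)
  exact h

end Runs

/-! ## §4 The modulus class of the far regime -/

/-- **SUPER-POLYNOMIAL SMALLNESS FROM ANY GEOMETRIC MAJORANT**: `0 ≤ τ J ≤ A'·r^J` with `0 ≤ r < 1` ⇒ `(J+1)^a·τ J → 0` for every `a`.  The far modulus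
`C·e^{−β_{J+1}δ₀²∕4} = C·e^{−δ₀²L^{J+1}∕(4γ…)}` is of this class (`L^{J+1} ≥ J+1`). [folklore] -/
theorem superpoly_of_le_geometric_ratio {τ : ℕ → ℝ} {A' r : ℝ} (hr0 : 0 ≤ r) (hr : r < 1) (h0 : ∀ J, 0 ≤ τ J)
    (hle : ∀ J, τ J ≤ A' * r ^ J) (a : ℕ) :
    Tendsto (fun J : ℕ => ((J : ℝ) + 1) ^ a * τ J) atTop (𝓝 0) := by
  have h := tendsto_pow_const_mul_const_pow_of_abs_lt_one a (r := r) (by rwa [abs_of_nonneg hr0])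
  -- shift by one: `(J+1)^a r^(J+1) → 0`; `r^J ≤ r^J`, and `(J+1)^a r^J = r⁻¹ (J+1)^a r^(J+1)` when `r > 0`; handle `r = 0` separately
  rcases hr0.lt_or_eq with hrpos | hrzero
  · have h1 : Tendsto (fun J : ℕ => (((J + 1 : ℕ) : ℝ)) ^ a * r ^ (J + 1)) atTop (𝓝 0) := h.comp (tendsto_add_atTop_nat 1)
    have h2 : Tendsto (fun J : ℕ => (r⁻¹ * A') * ((((J + 1 : ℕ) : ℝ)) ^ a * r ^ (J + 1))) atTop (𝓝 0) := by
      simpa using h1.const_mul (r⁻¹ * A')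
    have hmaj : ∀ J : ℕ, ((J : ℝ) + 1) ^ a * τ J ≤ (r⁻¹ * A') * ((((J + 1 : ℕ) : ℝ)) ^ a * r ^ (J + 1)) := by
      intro J
      have hJ : ((J : ℝ) + 1) ^ a * τ J ≤ ((J : ℝ) + 1) ^ a * (A' * r ^ J) := mul_le_mul_of_nonneg_left (hle J) (by positivity)
      refine hJ.trans (le_of_eq ?_)
      push_cast
      rw [pow_succ]
      field_simp
    exact squeeze_zero (fun J => mul_nonneg (by positivity) (h0 J)) hmaj h2
  · -- `r = 0`: `τ J ≤ A'·0^J` forces `τ J = 0` for `J ≥ 1`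
    subst hrzero
    refine tendsto_atTop_of_eventually_const (i₀ := 1) fun J hJ => ?_
    have hτ : τ J = 0 := by
      have := hle J
      rw [zero_pow (by omega), mul_zero] at this
      exact le_antisymm this (h0 J)
    rw [hτ, mul_zero]

end Summit.QuantumFields.YangMills.Theorems.FluctuationComparisonRegPrIntLTailSupOneFarPlaquetteCost

end
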